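import Literature.NumberTheory.Automorphic.WeilFamilyOfCoherentTorusDatum        -- ★ (W4b): `exists_isQuotientOf_of_coherent_torusDatum`
import Literature.NumberTheory.Rogawski1990.ArchSplitRationalWallTorusPoint     -- ★ (m2): `exists_eq_conj_diagonal_of_split`, `isConj_coe_cmRationalToArch_coe_archDiagTorus`, `isStablyConj_archCongr_of_isConj_coe`, `archDiagTorus_wall_coords`
import Literature.NumberTheory.Automorphic.ArchStableClassTorus                  -- ★ `exists_isConj_archDiagTorus_of_isStablyConj_of_conj`
import Literature.NumberTheory.Rogawski1990.AdelicStableOrbitalCentralH          -- ★ `coe_coe_cmRationalToArch_eq_smul_one_of_smul_one`, `commute_of_coe_eq_smul_one`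
import Literature.NumberTheory.Rogawski1990.SingularStableClassTransfers         -- ★ `exists_ne_mul_sub_eq_zero_of_isSemisimpleElt_of_not_isRegularElt_cm`
import Literature.NumberTheory.Rogawski1990.AnisotropicUnitarySemisimple         -- ★ `isSemisimpleElt_of_anisotropic`
import HarnessLib

/-!
# THE ARCHIMEDEAN SINGULAR WITNESS FAMILY on `U(H₂)(L ⊗ ℝ)` read on the diagonal carrier: Weil form at the non-regular rational classes, probability one-point orbit spaces at the
# centre, and the pinned singular members at every wall torus point («(W4c)»; Rogawski 1990 §1.7, §4.3 (4.3.1), Prop. 10.1.2 (b), §14.2, Lemma 14.5.2 (b))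

Topic `NumberTheory/Rogawski1990`; namespace `Literature.NumberTheory.Rogawski1990`.  THEOREMS ONLY (no `def`, no instance, no notation, no axiom, no named fact, no `sorry`).
Cell `pub/hodgecm-mathlib`, ENGINE T1 (crux H413 = `stmt-HodgeConjecture-24833`); the (ST-∞) witness road, brick (W4c) (F0P3a-p07 (g9); LEAD F0P3a-plan (g10) lane T9-8 (G)): the
instantiation of ★ (W4b) `exists_isQuotientOf_of_coherent_torusDatum` at a CM carrier pair `U(H₂)(L ⊗ ℝ) ≃ₜ* U(diag β)(L ⊗ ℝ)` ((T-d) congruence `Φ_A : g ↦ T_A g T_A⁻¹`), with the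
guard of the letter S1′ (★ `TamagawaSingularMembersExist`, riders (Q-∞)∕(Q-q∞)) and F0P3-p03 (g10)'s (W3-all) coherent pinned torus datum `T` on the wall saturation
`Pall a := ∃ (k : {z0 ∕∕ wall}) ρ q, q · t(z0∘ρ) · q⁻¹ = a`.  Count-neutral; HONEST LABEL: HC_CM is proved only modulo the printed citations until rung 0 closes; pays nothing by itself.

WHAT.  **`exists_archSingularFamily_of_coherent_torusDatum`**: for `H′` hermitian anisotropic (the inner form carrying the rational elements), any second form `H₂` with a congruence
`Φ_A : U(H₂)(L ⊗ ℝ) ≃ₜ* U(diag β)(L ⊗ ℝ)` (`β` real, non-zero), two-sided Haar `ν′` on `U(H₂)(L ⊗ ℝ)` and `ν = (Φ_A)_* ν′`, and a torus datum `T` on `U(diag β)(L ⊗ ℝ)` Haar ∕ inversion-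
invariant ∕ conjugation-coherent on `Pall`, THERE ARE a family `ms` on `U(H₂)(L ⊗ ℝ)` and a datum `Ts` with
(Q) `ms.IsQuotientOf (fun x => ∃ γ₀ ∈ U(H′)(L⁺) non-regular, γ₀ ⊗ 1 ↔ x) ν′ Ts` — the (Q-∞)∕(Q-q∞) rider of S1′ VERBATIM (a non-regular rational `γ₀` of the anisotropic `U(H′)` is
semisimple (★), hence central or split (★ Prop. 3.8.1 (a)); its correspondents are the scalar `ζ•1 ⊗ 1` or lie in the wall saturation through `Φ_A` (★ (m2) + ★ stable class of a torus
point = its relabelled classes)); (INV) `ms` is invariant at every class; (C1) `ms.atPoint (δ ⊗ 1)` has mass `1` at every rational scalar `δ = ζ•1 ∈ U(H₂)(L⁺)` [Prop. 10.1.2 (b)];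
(PIN) at every wall torus point `t(z0∘ρ)` of the diagonal carrier, `((Φ_A)_* ms).atPoint (t(z0∘ρ)) = dν ∕ dT_{t(z0∘ρ)}` — with (W3-all)'s `T (t(z0∘ρ)) = ρ′ ρ` this is the `hq` of
★ `archStableOrbitalIntegral_signed_eq_of_isArchInnerTransfer_of_pinned` (p843392).

## References
* [Rogawski1990] J. D. Rogawski, *Automorphic Representations of Unitary Groups in Three Variables*, Ann. of Math. Stud. 123 (1990), §1.7 p. 6; §3.8 Prop. 3.8.1 (a) p. 27; §4.3 (4.3.1)
  p. 43; Prop. 10.1.2 (b) p. 146; §14.2 (14.2.1) p. 232; §14.5 Lemma 14.5.2 (b) pp. 238–239.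
* [DeitmarEchterhoff2014] A. Deitmar, S. Echterhoff, *Principles of Harmonic Analysis*, 2nd ed. (2014), Thm. 1.5.3.
* [BorelJacquet1979] A. Borel, H. Jacquet, *Automorphic forms and automorphic representations*, PSPM 33.1 (1979), §4.1.
-/

set_option autoImplicit false

noncomputable section

open MeasureTheory Measure Set NumberField NumberField.InfinitePlace NumberField.mixedEmbedding Equiv
open Literature.MeasureTheory.Group Literature.NumberTheory.Automorphic
open Literature.NumberTheory.Automorphic.UnitaryGroup hiding hermForm
open Literature.AlgebraicGeometry.ShimuraVarieties (unitaryGroup hermForm)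
open scoped Matrix MatrixGroups

namespace Literature.NumberTheory.Rogawski1990

section ArchWitness

variable (L : Type) [Field L] [NumberField L] [IsCMField L] (H' : Matrix (Fin 3) (Fin 3) L) {H₂ : Matrix (Fin 3) (Fin 3) L} (β : Fin 3 → L)
  (T_A : GL (Fin 3) (mixedSpace L))
  (Φ_A : arch (↥(maximalRealSubfield L)) L (IsCMField.complexConj L) 3 H₂ ≃ₜ* arch (↥(maximalRealSubfield L)) L (IsCMField.complexConj L) 3 (Matrix.diagonal β))
  (hΦ_A : ∀ g : arch (↥(maximalRealSubfield L)) L (IsCMField.complexConj L) 3 H₂,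
    ((Φ_A g : arch (↥(maximalRealSubfield L)) L (IsCMField.complexConj L) 3 (Matrix.diagonal β)) : GL (Fin 3) (mixedSpace L)) = T_A * (g : GL (Fin 3) (mixedSpace L)) * T_A⁻¹)

include hΦ_A in
/-- **A `U(diag β)(L ⊗ ℝ)`-conjugate of a WALL torus point is not the image of a scalar**: `q · t(z0∘ρ) · q⁻¹ = Φ_A x` with `z0_w 0 ≠ z0_w 1` is impossible when `x ∈ U(H₂)(L ⊗ ℝ)`
is the scalar `ζ ⊗ 1` — then `t(z0∘ρ) = ζ ⊗ 1` (scalars are central) and its diagonal entries at `ρ_w⁻¹ 0`, `ρ_w⁻¹ 1` coincide (★ `coe_archDiagTorus_eq_diagonal`).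
[cite: Rogawski1990, §3.1 p. 19; §8.2 p. 117] -/
theorem conj_archDiagTorus_ne_archCongr_of_coe_eq_smul_one {x : arch (↥(maximalRealSubfield L)) L (IsCMField.complexConj L) 3 H₂} {ζ : L}
    (hx : ((x : GL (Fin 3) (mixedSpace L)) : Matrix (Fin 3) (Fin 3) (mixedSpace L)) = mixedEmbedding L ζ • (1 : Matrix (Fin 3) (Fin 3) (mixedSpace L)))
    (z0 : {w : InfinitePlace L // IsComplex w} → Fin 3 → Circle) (w₀ : {w : InfinitePlace L // IsComplex w}) (hw : z0 w₀ 0 ≠ z0 w₀ 1)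
    (ρ : {w : InfinitePlace L // IsComplex w} → Perm (Fin 3)) (q : arch (↥(maximalRealSubfield L)) L (IsCMField.complexConj L) 3 (Matrix.diagonal β)) :
    (MulAut.conj q : arch (↥(maximalRealSubfield L)) L (IsCMField.complexConj L) 3 (Matrix.diagonal β) ≃* arch (↥(maximalRealSubfield L)) L (IsCMField.complexConj L) 3 (Matrix.diagonal β)) (archDiagTorus L 3 β fun w => z0 w ∘ ⇑(ρ w)) ≠ Φ_A x := by
  intro h
  -- `Φ_A x` is the scalar `ζ ⊗ 1`
  have hΦx : (((Φ_A x : arch (↥(maximalRealSubfield L)) L (IsCMField.complexConj L) 3 (Matrix.diagonal β)) : GL (Fin 3) (mixedSpace L)) : Matrix (Fin 3) (Fin 3) (mixedSpace L)) =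
      mixedEmbedding L ζ • (1 : Matrix (Fin 3) (Fin 3) (mixedSpace L)) := by
    rw [hΦ_A x, commute_of_coe_eq_smul_one hx T_A, mul_inv_cancel_right, hx]
  -- hence so is the torus point (scalars are central)
  have h1 : ((q : GL (Fin 3) (mixedSpace L)) * ((archDiagTorus L 3 β fun w => z0 w ∘ ⇑(ρ w) : arch (↥(maximalRealSubfield L)) L (IsCMField.complexConj L) 3 (Matrix.diagonal β)) : GL (Fin 3) (mixedSpace L)) *
      (q : GL (Fin 3) (mixedSpace L))⁻¹) = ((Φ_A x : arch (↥(maximalRealSubfield L)) L (IsCMField.complexConj L) 3 (Matrix.diagonal β)) : GL (Fin 3) (mixedSpace L)) := by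
    have e := congrArg (fun g : arch (↥(maximalRealSubfield L)) L (IsCMField.complexConj L) 3 (Matrix.diagonal β) => (g : GL (Fin 3) (mixedSpace L))) h
    simpa only [MulAut.conj_apply, Subgroup.coe_mul, Subgroup.coe_inv] using e
  have hGL : (((archDiagTorus L 3 β fun w => z0 w ∘ ⇑(ρ w) : arch (↥(maximalRealSubfield L)) L (IsCMField.complexConj L) 3 (Matrix.diagonal β)) : GL (Fin 3) (mixedSpace L))) =
      ((Φ_A x : arch (↥(maximalRealSubfield L)) L (IsCMField.complexConj L) 3 (Matrix.diagonal β)) : GL (Fin 3) (mixedSpace L)) := by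
    calc (((archDiagTorus L 3 β fun w => z0 w ∘ ⇑(ρ w) : arch (↥(maximalRealSubfield L)) L (IsCMField.complexConj L) 3 (Matrix.diagonal β)) : GL (Fin 3) (mixedSpace L)))
        = (q : GL (Fin 3) (mixedSpace L))⁻¹ * ((q : GL (Fin 3) (mixedSpace L)) * ((archDiagTorus L 3 β fun w => z0 w ∘ ⇑(ρ w) : arch (↥(maximalRealSubfield L)) L (IsCMField.complexConj L) 3 (Matrix.diagonal β)) :
            GL (Fin 3) (mixedSpace L)) * (q : GL (Fin 3) (mixedSpace L))⁻¹) * (q : GL (Fin 3) (mixedSpace L)) := by group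
      _ = (q : GL (Fin 3) (mixedSpace L))⁻¹ * ((Φ_A x : arch (↥(maximalRealSubfield L)) L (IsCMField.complexConj L) 3 (Matrix.diagonal β)) : GL (Fin 3) (mixedSpace L)) * (q : GL (Fin 3) (mixedSpace L)) := by
          rw [h1]
      _ = ((Φ_A x : arch (↥(maximalRealSubfield L)) L (IsCMField.complexConj L) 3 (Matrix.diagonal β)) : GL (Fin 3) (mixedSpace L)) := by
          rw [commute_of_coe_eq_smul_one hΦx, inv_mul_cancel_right]
  have hd := coe_archDiagTorus_eq_diagonal L 3 β (fun w => z0 w ∘ ⇑(ρ w))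
  rw [hGL, hΦx] at hd
  -- read the diagonal entries: every `z0 w (ρ_w i)` is `σ_w ζ`
  have hent : ∀ i : Fin 3, ((z0 w₀ (ρ w₀ i) : Circle) : ℂ) = (mixedEmbedding L ζ).2 w₀ := by
    intro i
    have e := congrFun (congrFun hd i) i
    simp only [Matrix.smul_apply, Matrix.one_apply_eq, Matrix.diagonal_apply_eq, smul_eq_mul, mul_one] at e
    have e2 := congrArg (fun p : mixedSpace L => p.2 w₀) e
    simpa using e2.symm
  have e0 := hent ((ρ w₀).symm 0)
  have e1 := hent ((ρ w₀).symm 1)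
  rw [Equiv.apply_symm_apply] at e0 e1
  exact hw (Circle.ext (by rw [e0, e1]))

variable
  [MeasurableSpace (arch (↥(maximalRealSubfield L)) L (IsCMField.complexConj L) 3 H₂)] [BorelSpace (arch (↥(maximalRealSubfield L)) L (IsCMField.complexConj L) 3 H₂)]
  [MeasurableSpace (arch (↥(maximalRealSubfield L)) L (IsCMField.complexConj L) 3 (Matrix.diagonal β))]
  [BorelSpace (arch (↥(maximalRealSubfield L)) L (IsCMField.complexConj L) 3 (Matrix.diagonal β))]
  [∀ γ : arch (↥(maximalRealSubfield L)) L (IsCMField.complexConj L) 3 H₂,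
    MeasurableSpace (arch (↥(maximalRealSubfield L)) L (IsCMField.complexConj L) 3 H₂ ⧸ Subgroup.centralizer ({γ} : Set _))]
  [∀ γ : arch (↥(maximalRealSubfield L)) L (IsCMField.complexConj L) 3 H₂,
    BorelSpace (arch (↥(maximalRealSubfield L)) L (IsCMField.complexConj L) 3 H₂ ⧸ Subgroup.centralizer ({γ} : Set _))]
  [∀ γ : arch (↥(maximalRealSubfield L)) L (IsCMField.complexConj L) 3 (Matrix.diagonal β),
    MeasurableSpace (arch (↥(maximalRealSubfield L)) L (IsCMField.complexConj L) 3 (Matrix.diagonal β) ⧸ Subgroup.centralizer ({γ} : Set _))]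
  [∀ γ : arch (↥(maximalRealSubfield L)) L (IsCMField.complexConj L) 3 (Matrix.diagonal β),
    BorelSpace (arch (↥(maximalRealSubfield L)) L (IsCMField.complexConj L) 3 (Matrix.diagonal β) ⧸ Subgroup.centralizer ({γ} : Set _))]

include hΦ_A in
open scoped Classical in
/-- **(W4c) THE ARCHIMEDEAN SINGULAR WITNESS FAMILY.**  `H′` hermitian anisotropic; `H₂` any second form with a congruence `Φ_A : U(H₂)(L ⊗ ℝ) ≃ₜ* U(diag β)(L ⊗ ℝ)`, `g ↦ T_A g T_A⁻¹`
(`β` real non-zero); `ν′` a two-sided Haar measure on `U(H₂)(L ⊗ ℝ)`, `ν = (Φ_A)_* ν′`; `T` a torus datum on `U(diag β)(L ⊗ ℝ)` Haar, inversion-invariant and conjugation-coherent on the wall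
saturation `Pall a := ∃ (k : {z0 ∕∕ wall}) ρ q, q·t(z0∘ρ)·q⁻¹ = a` (F0P3-p03 (g10)'s (W3-all) datum).  THEN there are `ms`, `Ts` on `U(H₂)(L ⊗ ℝ)` with: (Q) `ms.IsQuotientOf` the S1′ guard
«`∃ γ₀ ∈ U(H′)(L⁺)` non-regular with `γ₀ ⊗ 1 ↔ x`» `ν′ Ts` ((Q-∞)∕(Q-q∞) VERBATIM); (INV) `ms` invariant at every class; (C1) `ms.atPoint (δ ⊗ 1) (univ) = 1` at every rational scalar
`δ = ζ•1 ∈ U(H₂)(L⁺)` [Prop. 10.1.2 (b)]; (PIN) `((Φ_A)_* ms).atPoint (t(z0∘ρ)) = dν ∕ dT_{t(z0∘ρ)}` at every wall torus point.  Proof: ★ (W4b) with `P := Pall`, `Cen x := x = ζ ⊗ 1`;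
the guard lands in `Pall ∘ Φ_A ∨ Cen` since a non-regular `γ₀` of the anisotropic `U(H′)` is semisimple (★), hence `(γ₀ − a)(γ₀ − b) = 0` (★ Prop. 3.8.1 (a)): central ⇒ its correspondents
are the scalar `ζ ⊗ 1`; else `γ₀ ⊗ 1 ∼ t(zw)` in `GL₃(L ⊗ ℝ)` (★ (m2)) and the stable class of `t(zw)` is the union of the classes of the `t(zw∘ρ)` (★).
[cite: Rogawski1990, §1.7 p. 6; §3.8 Prop. 3.8.1 (a) p. 27; §4.3 (4.3.1) p. 43; Prop. 10.1.2 (b) p. 146; §14.2 p. 232; §14.5 Lemma 14.5.2 (b) pp. 238–239] [cite: DeitmarEchterhoff2014, Thm. 1.5.3] -/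
theorem exists_archSingularFamily_of_coherent_torusDatum (hherm : (H'.map (cmConjRingHom L))ᵀ = H')
    (hanis : ∀ x : Fin 3 → L, hermForm (cmConjRingHom L) H' x x = 0 → x = 0) (hβ : ∀ i, β i ≠ 0) (hhermβ : ∀ i, (IsCMField.complexConj L (β i) : L) = β i)
    (ν' : Measure (arch (↥(maximalRealSubfield L)) L (IsCMField.complexConj L) 3 H₂)) [ν'.IsHaarMeasure] [ν'.IsMulRightInvariant]
    (ν : Measure (arch (↥(maximalRealSubfield L)) L (IsCMField.complexConj L) 3 (Matrix.diagonal β))) [ν.IsHaarMeasure] [ν.IsMulRightInvariant] (hν : ν = Measure.map Φ_A ν')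
    (T : ∀ a : arch (↥(maximalRealSubfield L)) L (IsCMField.complexConj L) 3 (Matrix.diagonal β), Measure (Subgroup.centralizer ({a} : Set (arch (↥(maximalRealSubfield L)) L (IsCMField.complexConj L) 3 (Matrix.diagonal β)))))
    (hTi : ∀ a : arch (↥(maximalRealSubfield L)) L (IsCMField.complexConj L) 3 (Matrix.diagonal β),
      (∃ (k : {z0 : {w : InfinitePlace L // IsComplex w} → Fin 3 → Circle // ∀ w, z0 w 0 = z0 w 2 ∧ z0 w 0 ≠ z0 w 1})
        (ρ : {w : InfinitePlace L // IsComplex w} → Perm (Fin 3)) (q : arch (↥(maximalRealSubfield L)) L (IsCMField.complexConj L) 3 (Matrix.diagonal β)),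
        (MulAut.conj q : arch (↥(maximalRealSubfield L)) L (IsCMField.complexConj L) 3 (Matrix.diagonal β) ≃* arch (↥(maximalRealSubfield L)) L (IsCMField.complexConj L) 3 (Matrix.diagonal β)) (archDiagTorus L 3 β fun w => k.1 w ∘ ⇑(ρ w)) = a) →
      (T a).IsHaarMeasure ∧ (T a).IsInvInvariant)
    (hcoh : ∀ (a₁ a₂ q : arch (↥(maximalRealSubfield L)) L (IsCMField.complexConj L) 3 (Matrix.diagonal β)) (hq : (MulAut.conj q : arch (↥(maximalRealSubfield L)) L (IsCMField.complexConj L) 3 (Matrix.diagonal β) ≃* arch (↥(maximalRealSubfield L)) L (IsCMField.complexConj L) 3 (Matrix.diagonal β)) a₁ = a₂),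
      (∃ (k : {z0 : {w : InfinitePlace L // IsComplex w} → Fin 3 → Circle // ∀ w, z0 w 0 = z0 w 2 ∧ z0 w 0 ≠ z0 w 1})
        (ρ : {w : InfinitePlace L // IsComplex w} → Perm (Fin 3)) (q : arch (↥(maximalRealSubfield L)) L (IsCMField.complexConj L) 3 (Matrix.diagonal β)),
        (MulAut.conj q : arch (↥(maximalRealSubfield L)) L (IsCMField.complexConj L) 3 (Matrix.diagonal β) ≃* arch (↥(maximalRealSubfield L)) L (IsCMField.complexConj L) 3 (Matrix.diagonal β)) (archDiagTorus L 3 β fun w => k.1 w ∘ ⇑(ρ w)) = a₁) →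
      Measure.map (subgroupCongrHomeomorph (MulAut.conj q : arch (↥(maximalRealSubfield L)) L (IsCMField.complexConj L) 3 (Matrix.diagonal β) ≃* arch (↥(maximalRealSubfield L)) L (IsCMField.complexConj L) 3 (Matrix.diagonal β))
        (Subgroup.centralizer ({a₁} : Set (arch (↥(maximalRealSubfield L)) L (IsCMField.complexConj L) 3 (Matrix.diagonal β)))) (Subgroup.centralizer ({a₂} : Set (arch (↥(maximalRealSubfield L)) L (IsCMField.complexConj L) 3 (Matrix.diagonal β))))
        (forall_apply_mem_centralizer_singleton_iff_of_eq (MulAut.conj q : arch (↥(maximalRealSubfield L)) L (IsCMField.complexConj L) 3 (Matrix.diagonal β) ≃* arch (↥(maximalRealSubfield L)) L (IsCMField.complexConj L) 3 (Matrix.diagonal β)) hq)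
        (continuous_mulAutConj q) (continuous_mulAutConj_symm q)) (T a₁) = T a₂) :
    ∃ (ms : OrbitalMeasureFamily (arch (↥(maximalRealSubfield L)) L (IsCMField.complexConj L) 3 H₂)) (Ts : ∀ x : arch (↥(maximalRealSubfield L)) L (IsCMField.complexConj L) 3 H₂, Measure (Subgroup.centralizer ({x} : Set (arch (↥(maximalRealSubfield L)) L (IsCMField.complexConj L) 3 H₂)))),
      ms.IsQuotientOf (fun x : arch (↥(maximalRealSubfield L)) L (IsCMField.complexConj L) 3 H₂ => ∃ γ₀ : (cmDatum L 3 H').Rational, ¬ IsRegularElt (γ₀.val : GL (Fin 3) L) ∧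
          Corresponds (conjMixed (↥(maximalRealSubfield L)) L (IsCMField.complexConj L)) (archFormOf L 3 H') (archFormOf L 3 H₂) (cmRationalToArch L 3 H' γ₀) x) ν' Ts ∧
      (∀ c : ConjClasses (arch (↥(maximalRealSubfield L)) L (IsCMField.complexConj L) 3 H₂), SMulInvariantMeasure (arch (↥(maximalRealSubfield L)) L (IsCMField.complexConj L) 3 H₂) (arch (↥(maximalRealSubfield L)) L (IsCMField.complexConj L) 3 H₂ ⧸ Subgroup.centralizer ({(Quotient.out c : arch (↥(maximalRealSubfield L)) L (IsCMField.complexConj L) 3 H₂)} : Set (arch (↥(maximalRealSubfield L)) L (IsCMField.complexConj L) 3 H₂))) (ms c)) ∧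
      (∀ (δ : (cmDatum L 3 H₂).Rational) (ζ : L), (((δ : unitaryGroup (cmConjRingHom L) H₂).val : GL (Fin 3) L) : Matrix (Fin 3) (Fin 3) L) = ζ • (1 : Matrix (Fin 3) (Fin 3) L) →
        ms.atPoint (cmRationalToArch L 3 H₂ δ) Set.univ = 1) ∧
      (∀ (z0 : {w : InfinitePlace L // IsComplex w} → Fin 3 → Circle) (_ : ∀ w, z0 w 0 = z0 w 2 ∧ z0 w 0 ≠ z0 w 1) (ρ : {w : InfinitePlace L // IsComplex w} → Perm (Fin 3)),
        ∃ (_ : (T (archDiagTorus L 3 β fun w => z0 w ∘ ⇑(ρ w))).IsHaarMeasure) (_ : (T (archDiagTorus L 3 β fun w => z0 w ∘ ⇑(ρ w))).IsInvInvariant),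
          (ms.transport Φ_A.toMulEquiv Φ_A.continuous Φ_A.symm.continuous).atPoint (archDiagTorus L 3 β fun w => z0 w ∘ ⇑(ρ w)) =
            quotientMeasure (Subgroup.centralizer ({archDiagTorus L 3 β fun w => z0 w ∘ ⇑(ρ w)} : Set (arch (↥(maximalRealSubfield L)) L (IsCMField.complexConj L) 3 (Matrix.diagonal β))))
              (T (archDiagTorus L 3 β fun w => z0 w ∘ ⇑(ρ w))) (isClosed_coe_centralizer_singleton _) ν) := by
  haveI : ∀ γ : arch (↥(maximalRealSubfield L)) L (IsCMField.complexConj L) 3 H₂, LocallyCompactSpace (arch (↥(maximalRealSubfield L)) L (IsCMField.complexConj L) 3 H₂) := fun _ => inferInstance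
  have hdet : H'.det ≠ 0 := Godement.det_ne_zero_of_anisotropic L H' hanis
  -- the generic construction ★ (W4b), `P := Pall`, `Cen x := x is a scalar ζ ⊗ 1`
  obtain ⟨ms, Ts, hQ, hinv, hcen, hwall⟩ := exists_isQuotientOf_of_coherent_torusDatum Φ_A.toMulEquiv Φ_A.continuous Φ_A.symm.continuous ν' ν hν
    (P := fun a : arch (↥(maximalRealSubfield L)) L (IsCMField.complexConj L) 3 (Matrix.diagonal β) =>
      ∃ (k : {z0 : {w : InfinitePlace L // IsComplex w} → Fin 3 → Circle // ∀ w, z0 w 0 = z0 w 2 ∧ z0 w 0 ≠ z0 w 1})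
        (ρ : {w : InfinitePlace L // IsComplex w} → Perm (Fin 3)) (q : arch (↥(maximalRealSubfield L)) L (IsCMField.complexConj L) 3 (Matrix.diagonal β)),
        (MulAut.conj q : arch (↥(maximalRealSubfield L)) L (IsCMField.complexConj L) 3 (Matrix.diagonal β) ≃* arch (↥(maximalRealSubfield L)) L (IsCMField.complexConj L) 3 (Matrix.diagonal β)) (archDiagTorus L 3 β fun w => k.1 w ∘ ⇑(ρ w)) = a)
    (fun a q' ⟨k, ρ, q, hq⟩ => ⟨k, ρ, q' * q, by rw [map_mul, MulAut.mul_apply, hq, MulAut.conj_apply]⟩)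
    (Cen := fun x : arch (↥(maximalRealSubfield L)) L (IsCMField.complexConj L) 3 H₂ => ∃ ζ : L, ((x : GL (Fin 3) (mixedSpace L)) : Matrix (Fin 3) (Fin 3) (mixedSpace L)) = mixedEmbedding L ζ • (1 : Matrix (Fin 3) (Fin 3) (mixedSpace L)))
    (fun x ⟨ζ, hx⟩ g => Subtype.ext (commute_of_coe_eq_smul_one hx (g : GL (Fin 3) (mixedSpace L))))
    (fun x ⟨ζ, hx⟩ ⟨k, ρ, q, hq⟩ => by
      obtain ⟨w₀⟩ : Nonempty {w : InfinitePlace L // IsComplex w} := ⟨⟨Classical.arbitrary (InfinitePlace L), IsTotallyComplex.isComplex _⟩⟩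
      exact conj_archDiagTorus_ne_archCongr_of_coe_eq_smul_one L β T_A Φ_A hΦ_A hx k.1 w₀ (k.2 w₀).2 ρ q hq)
    T hTi hcoh
  refine ⟨ms, Ts, hQ.mono fun x hx => ?_, hinv, fun δ ζ hδ => hcen _ ⟨ζ, coe_coe_cmRationalToArch_eq_smul_one_of_smul_one hδ⟩, fun z0 hz0 ρ => hwall _ ⟨⟨z0, hz0⟩, ρ, 1, by simp⟩⟩
  -- the guard lands in `Pall ∘ Φ_A ∨ Cen`
  obtain ⟨γ₀, hnreg, hcorr⟩ := hx
  have hss : IsSemisimpleElt (cmConjRingHom L) H' (γ₀ : unitaryGroup (cmConjRingHom L) H') := isSemisimpleElt_of_anisotropic (cmConjRingHom L) H' hanis _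
  obtain ⟨e₁, e₂, he, h₁, h₂, hsplit⟩ := exists_ne_mul_sub_eq_zero_of_isSemisimpleElt_of_not_isRegularElt_cm L hherm hdet _ hss hnreg
  by_cases hc : ∃ ζ : L, (((γ₀ : unitaryGroup (cmConjRingHom L) H').val : GL (Fin 3) L) : Matrix (Fin 3) (Fin 3) L) = ζ • (1 : Matrix (Fin 3) (Fin 3) L)
  · -- central: the correspondent IS the scalar `ζ ⊗ 1`
    obtain ⟨ζ, hζ⟩ := hc
    refine Or.inr ⟨ζ, ?_⟩
    have h0 := coe_coe_cmRationalToArch_eq_smul_one_of_smul_one (L := L) (H := H') hζ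
    obtain ⟨g, hg⟩ := isConj_iff.1 hcorr
    rw [← hg, commute_of_coe_eq_smul_one h0 g, mul_inv_cancel_right, h0]
  · -- split non-central: `Φ_A x ∼_st t(zw)`, and the stable class of `t(zw)` is the union of the classes of the `t(zw∘ρ)`
    obtain ⟨a, b, Q, hab, ha, hb, hγ, -⟩ := exists_eq_conj_diagonal_of_split L H' hherm hanis (γ₀ : unitaryGroup (cmConjRingHom L) H') he hsplit
      (fun h => hc ⟨e₁, h⟩) (fun h => hc ⟨e₂, h⟩)
    have hab' : a ≠ b := by
      rcases hab with ⟨rfl, rfl⟩ | ⟨rfl, rfl⟩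
      · exact he
      · exact he.symm
    have ha' : (IsCMField.complexConj L a : L) * a = 1 := ha
    have hb' : (IsCMField.complexConj L b : L) * b = 1 := hb
    obtain ⟨zw, hzw⟩ : ∃ zw : {w : InfinitePlace L // IsComplex w} → Fin 3 → Circle, zw = fun w =>
      ![(⟨w.1.embedding a, mem_sphere_zero_iff_norm.mpr (norm_embedding_eq_one_of_complexConj_mul_self L a ha' w)⟩ : Circle),
        ⟨w.1.embedding b, mem_sphere_zero_iff_norm.mpr (norm_embedding_eq_one_of_complexConj_mul_self L b hb' w)⟩,
        ⟨w.1.embedding a, mem_sphere_zero_iff_norm.mpr (norm_embedding_eq_one_of_complexConj_mul_self L a ha' w)⟩] := ⟨_, rfl⟩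
    have hwall : ∀ w, zw w 0 = zw w 2 ∧ zw w 0 ≠ zw w 1 := by
      intro w; subst hzw; exact archDiagTorus_wall_coords L hab' ha' hb' w
    -- `γ₀ ⊗ 1 ∼ t_β(zw)` in `GL₃(L ⊗ ℝ)` (carrier-blind), `γ₀ ⊗ 1 ∼ x`, so `Φ_A x ∼_st t_β(zw)`
    have ht : IsConj ((cmRationalToArch L 3 H' γ₀ : arch (↥(maximalRealSubfield L)) L (IsCMField.complexConj L) 3 H') : GL (Fin 3) (mixedSpace L))
        ((archDiagTorus L 3 β zw : arch (↥(maximalRealSubfield L)) L (IsCMField.complexConj L) 3 (Matrix.diagonal β)) : GL (Fin 3) (mixedSpace L)) :=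
      isConj_coe_cmRationalToArch_coe_archDiagTorus L H' β γ₀ Q hγ zw fun w i => by subst hzw; fin_cases i <;> rfl
    have hst := isStablyConj_archCongr_of_isConj_coe L H₂ β T_A Φ_A hΦ_A (hcorr.symm.trans ht)
    obtain ⟨ρ, hρ⟩ := exists_isConj_archDiagTorus_of_isStablyConj_of_conj L 3 β hβ hhermβ zw (Φ_A x) hst.symm
    obtain ⟨q, hq⟩ := isConj_iff.1 hρ
    exact Or.inl ⟨⟨zw, hwall⟩, ρ, q, by rw [MulAut.conj_apply]; exact hq⟩

end ArchWitness

end Literature.NumberTheory.Rogawski1990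

end
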